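import Literature.MathematicalPhysics.QuantumFieldTheory.MassGapFromLatticeClustering
import Literature.MathematicalPhysics.QuantumFieldTheory.MassGapFromDiagonalClustering
import Literature.MathematicalPhysics.QuantumFieldTheory.OSTransferSelfImprovement
import HarnessLib

/-!
# Cauchy–Schwarz clustering of a lattice approximation FROM the full-spectrum gap of its limit

Topic `MathematicalPhysics/QuantumFieldTheory` (families `constructive-qft`, `yang-mills`); sequel of
`MassGapFromLatticeClustering` (which proves `ClustersCS d Λ Δ → T.HasMassGap Δ` along a convergent lattice
approximation).  This file proves the CONVERSE, so that along a convergent approximation the lattice statement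
`ClustersCS d Λ Δ` IS the continuum gap clause `T.HasMassGap Δ`:

* `OSData.csBound_sum_of_hasMassGap` — the continuum Cauchy–Schwarz bound with the reflection-positive norms
  for finite sums of slab-ordered product tensors, from `T.HasMassGap Δ` (the per-tensor free constant of
  `HasMassGap` self-improves to `‖v‖²` in the OS Hilbert space by log-convexity with infinite horizon,
  `OSTransferSelfImprovement`; then linearity and Cauchy–Schwarz — the argument of
  `OSData.hasMassGap_of_diagBound`, steps (1)–(5), run from `HasMassGap`);
* `OSData.clustersCS_of_hasMassGap` — if `Λ k → 𝔖` on off-diagonal real product tensors (`n ≥ 1`) and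
  `T.HasMassGap Δ`, then `ClustersCS d Λ Δ` (every term of the sesquilinearly expanded lattice inequality
  converges to its continuum counterpart; the continuum inequality holds without slack, so with the slack
  `ε > 0` it is strict and holds eventually in `k`);
* instances for lattice QCD: `IsQCDAlong.hasSpeciesCSClustering_of_hasMassGap`,
  `IsQCDAlong.hasSpeciesCSClustering_iff_hasMassGap`.

Use (route HeatSlicedQuarks, crux RobustYangMillsHandover, line lee-yang-mass-handover): the registered stub
"per-pair lattice gap ⇒ species CS clustering for the honest species renormalisations" is thereby EQUIVALENT to the
`∃ Δ`-form of the lattice-to-continuum gap transfer (item GradientFlowSpecies.GapTransfer restricted to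
regularisation schemes) — the CS re-typing does not leave that kernel.

References: J. Glimm, A. Jaffe, *Quantum Physics* (1987) §6.1 Thm. 6.1.3 [GlimmJaffeQP1987];
K. Osterwalder, R. Schrader, CMP 31 (1973) §4.1 (4.3)–(4.9) [OsterwalderSchraderCMP1973];
K. Osterwalder, E. Seiler, Ann. Phys. 110 (1978) §§2–4 [OsterwalderSeiler1978];
A. Jaffe, E. Witten, *Quantum Yang–Mills theory* (2000) §5 [JaffeWitten2000].
Tree: `OSReconstructionNoE1` (field vectors, transfer semigroup, `re_inner_transfer_self_le_of_le_exp`,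
`norm_inner_transfer_le_of_le_exp`, `re_inner_transfer_self_le_sum`), `ClustersCS`,
`IsQCDAlong.hasMassGap_of_hasSpeciesCSClustering`.
-/

open scoped SchwartzMap ComplexConjugate InnerProductSpace
open Filter Topology Complex Set
open Literature.MathematicalPhysics.AQFT Literature.MathematicalPhysics.QuantumLattice

noncomputable section

namespace Literature.MathematicalPhysics.QuantumFieldTheory

namespace OSData

variable {ι : Type} {d : ℕ} [NeZero d] {n m : ℕ}

/-- **Cauchy–Schwarz bound on finite sums of slab-ordered product tensors from the full-spectrum gap.**
If `T.HasMassGap Δ` then for `F = ∑ cᵢ Pᵢ`, `G = ∑ c'ⱼ Qⱼ` (`Pᵢ`, `Qⱼ` slab-ordered real product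
tensors) and `t ≥ 0`,
`‖𝔖(ΘF* ⊗ T_t G) − 𝔖(ΘF*) 𝔖(G)‖ ≤ e^{−Δt} √‖𝔖(ΘF* ⊗ F)‖ √‖𝔖(ΘG* ⊗ G)‖`.
In the OS Hilbert space the per-tensor free constant of `HasMassGap` self-improves to `‖v‖²`
(log-convexity with infinite horizon), passes to the span, and Cauchy–Schwarz concludes.
[cite: GlimmJaffeQP1987, §6.1 Thm. 6.1.3] [cite: OsterwalderSchraderCMP1973, §4.1 eqs. (4.3)–(4.9)] -/
theorem csBound_sum_of_hasMassGap (T : OSData ι d) {Δ : ℝ} (hgap : T.HasMassGap Δ)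
    (k : Fin n → ι) (k' : Fin m → ι) {N N' : ℕ} (c : Fin N → ℂ) (c' : Fin N' → ℂ)
    (g : Fin N → ↥(slabOrderedProducts d n)) (g' : Fin N' → ↥(slabOrderedProducts d m))
    {t : ℝ} (ht : 0 ≤ t) :
    ‖T.schwinger (n + m) (Fin.append (k ∘ Fin.rev) k')
          ((osAdjoint (∑ i, c i • (g i : 𝓢((Fin n → EuclideanSpace ℝ (Fin d)), ℂ)))).appendTensor
            (translateMulti (EuclideanSpace.single 0 t)
              (∑ j, c' j • (g' j : 𝓢((Fin m → EuclideanSpace ℝ (Fin d)), ℂ))))) -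
        T.schwinger n (k ∘ Fin.rev)
            (osAdjoint (∑ i, c i • (g i : 𝓢((Fin n → EuclideanSpace ℝ (Fin d)), ℂ)))) *
          T.schwinger m k' (∑ j, c' j • (g' j : 𝓢((Fin m → EuclideanSpace ℝ (Fin d)), ℂ)))‖ ≤
      Real.exp (-Δ * t) *
        Real.sqrt ‖T.schwinger (n + n) (Fin.append (k ∘ Fin.rev) k)
          ((osAdjoint (∑ i, c i • (g i : 𝓢((Fin n → EuclideanSpace ℝ (Fin d)), ℂ)))).appendTensor
            (∑ i, c i • (g i : 𝓢((Fin n → EuclideanSpace ℝ (Fin d)), ℂ))))‖ *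
        Real.sqrt ‖T.schwinger (m + m) (Fin.append (k' ∘ Fin.rev) k')
          ((osAdjoint (∑ j, c' j • (g' j : 𝓢((Fin m → EuclideanSpace ℝ (Fin d)), ℂ)))).appendTensor
            (∑ j, c' j • (g' j : 𝓢((Fin m → EuclideanSpace ℝ (Fin d)), ℂ))))‖ := by
  have hOS : OSReconstructionNoE1 T.schwinger := OSReconstructionNoE1.of_osAxioms T.osAxioms
  have h0 : T.schwinger.IsNormalized := T.normalized
  -- (1) the vacuum-projected field vector of ONE slab-ordered real product tensor obeys the
  --     improved bound (self-improvement of the free constant of `HasMassGap`)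
  have hgood : ∀ (n : ℕ) (k : Fin n → ι)
      (P : 𝓢((Fin n → EuclideanSpace ℝ (Fin d)), ℂ)) (hP : P ∈ slabOrderedProducts d n) (t : ℝ),
      0 ≤ t →
      (⟪hOS.fieldVec n k P (IsTimeOrdered.of_mem_slabOrderedProducts hP) -
            ⟪hOS.vacuum, hOS.fieldVec n k P (IsTimeOrdered.of_mem_slabOrderedProducts hP)⟫_ℂ •
              hOS.vacuum,
          hOS.transfer t
            (hOS.fieldVec n k P (IsTimeOrdered.of_mem_slabOrderedProducts hP) -
              ⟪hOS.vacuum, hOS.fieldVec n k P (IsTimeOrdered.of_mem_slabOrderedProducts hP)⟫_ℂ •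
                hOS.vacuum)⟫_ℂ).re ≤
        ‖hOS.fieldVec n k P (IsTimeOrdered.of_mem_slabOrderedProducts hP) -
            ⟪hOS.vacuum, hOS.fieldVec n k P (IsTimeOrdered.of_mem_slabOrderedProducts hP)⟫_ℂ •
              hOS.vacuum‖ ^ 2 * Real.exp (-Δ * t) := by
    intro n k P hP
    have hPt : IsTimeOrdered P := IsTimeOrdered.of_mem_slabOrderedProducts hP
    obtain ⟨C, hC⟩ := hgap n n k k P P hPt hPt
    refine fun t ht => hOS.re_inner_transfer_self_le_of_le_exp (C := C) (fun s hs => ?_) ht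
    rw [hOS.inner_proj_transfer_proj h0, hOS.inner_fieldVec_transfer_fieldVec k k hPt hPt hs,
      hOS.inner_fieldVec_vacuum, hOS.inner_vacuum_fieldVec]
    exact (le_abs_self _).trans ((Complex.abs_re_le_norm _).trans
      (hC s hs _ (isAppendTensorOf_appendTensor _ _)))
  have hPi : ∀ i, IsTimeOrdered (g i : 𝓢((Fin n → EuclideanSpace ℝ (Fin d)), ℂ)) := fun i =>
    IsTimeOrdered.of_mem_slabOrderedProducts (g i).2
  have hQj : ∀ j, IsTimeOrdered (g' j : 𝓢((Fin m → EuclideanSpace ℝ (Fin d)), ℂ)) := fun j =>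
    IsTimeOrdered.of_mem_slabOrderedProducts (g' j).2
  -- the OS vectors of `F = ∑ cᵢ Pᵢ` and `G = ∑ c'ⱼ Qⱼ`
  set V : hOS.Hilbert := ∑ i, c i • hOS.fieldVec n k (g i) (hPi i) with hV
  set W : hOS.Hilbert := ∑ j, c' j • hOS.fieldVec m k' (g' j) (hQj j) with hW
  clear_value V W
  -- (3) matrix elements of `V, W` are the Schwinger functions of `F, G`
  have hVW : ⟪V, hOS.transfer t W⟫_ℂ = T.schwinger (n + m) (Fin.append (k ∘ Fin.rev) k')
      ((osAdjoint (∑ i, c i • (g i : 𝓢((Fin n → EuclideanSpace ℝ (Fin d)), ℂ)))).appendTensor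
        (translateMulti (EuclideanSpace.single 0 t)
          (∑ j, c' j • (g' j : 𝓢((Fin m → EuclideanSpace ℝ (Fin d)), ℂ))))) := by
    rw [map_sum (translateMulti (EuclideanSpace.single (0 : Fin d) t)),
      Finset.sum_congr rfl fun j _ =>
        map_smul (translateMulti (EuclideanSpace.single (0 : Fin d) t)) _ _,
      apply_osAdjoint_appendTensor_sum_smul, hV, hW, map_sum (hOS.transfer t), sum_inner]
    refine Finset.sum_congr rfl fun i _ => ?_
    rw [inner_sum]
    refine Finset.sum_congr rfl fun j _ => ?_
    rw [map_smul, inner_smul_left, inner_smul_right,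
      hOS.inner_fieldVec_transfer_fieldVec k k' (hPi i) (hQj j) ht]
    ring
  have hVΩ : ⟪V, hOS.vacuum⟫_ℂ = T.schwinger n (k ∘ Fin.rev)
      (osAdjoint (∑ i, c i • (g i : 𝓢((Fin n → EuclideanSpace ℝ (Fin d)), ℂ)))) := by
    rw [apply_osAdjoint_sum_smul, hV, sum_inner]
    refine Finset.sum_congr rfl fun i _ => ?_
    rw [inner_smul_left, hOS.inner_fieldVec_vacuum k (hPi i)]
  have hΩW : ⟪hOS.vacuum, W⟫_ℂ = T.schwinger m k'
      (∑ j, c' j • (g' j : 𝓢((Fin m → EuclideanSpace ℝ (Fin d)), ℂ))) := by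
    rw [apply_sum_smul, hW, inner_sum]
    refine Finset.sum_congr rfl fun j _ => ?_
    rw [inner_smul_right, hOS.inner_vacuum_fieldVec k' (hQj j)]
  have hVV : ⟪V, V⟫_ℂ = T.schwinger (n + n) (Fin.append (k ∘ Fin.rev) k)
      ((osAdjoint (∑ i, c i • (g i : 𝓢((Fin n → EuclideanSpace ℝ (Fin d)), ℂ)))).appendTensor
        (∑ i, c i • (g i : 𝓢((Fin n → EuclideanSpace ℝ (Fin d)), ℂ)))) := by
    rw [apply_osAdjoint_appendTensor_sum_smul, hV, sum_inner]
    refine Finset.sum_congr rfl fun i _ => ?_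
    rw [inner_sum]
    refine Finset.sum_congr rfl fun i' _ => ?_
    rw [inner_smul_left, inner_smul_right, hOS.inner_fieldVec_fieldVec_same k (hPi i) (hPi i')]
    ring
  have hWW : ⟪W, W⟫_ℂ = T.schwinger (m + m) (Fin.append (k' ∘ Fin.rev) k')
      ((osAdjoint (∑ j, c' j • (g' j : 𝓢((Fin m → EuclideanSpace ℝ (Fin d)), ℂ)))).appendTensor
        (∑ j, c' j • (g' j : 𝓢((Fin m → EuclideanSpace ℝ (Fin d)), ℂ)))) := by
    rw [apply_osAdjoint_appendTensor_sum_smul, hW, sum_inner]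
    refine Finset.sum_congr rfl fun j _ => ?_
    rw [inner_sum]
    refine Finset.sum_congr rfl fun j' _ => ?_
    rw [inner_smul_left, inner_smul_right, hOS.inner_fieldVec_fieldVec_same k' (hQj j) (hQj j')]
    ring
  have hnV : Real.sqrt ‖T.schwinger (n + n) (Fin.append (k ∘ Fin.rev) k)
      ((osAdjoint (∑ i, c i • (g i : 𝓢((Fin n → EuclideanSpace ℝ (Fin d)), ℂ)))).appendTensor
        (∑ i, c i • (g i : 𝓢((Fin n → EuclideanSpace ℝ (Fin d)), ℂ))))‖ = ‖V‖ := by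
    rw [← hVV, inner_self_eq_norm_sq_to_K, norm_pow, RCLike.norm_ofReal, abs_norm,
      Real.sqrt_sq (norm_nonneg _)]
  have hnW : Real.sqrt ‖T.schwinger (m + m) (Fin.append (k' ∘ Fin.rev) k')
      ((osAdjoint (∑ j, c' j • (g' j : 𝓢((Fin m → EuclideanSpace ℝ (Fin d)), ℂ)))).appendTensor
        (∑ j, c' j • (g' j : 𝓢((Fin m → EuclideanSpace ℝ (Fin d)), ℂ))))‖ = ‖W‖ := by
    rw [← hWW, inner_self_eq_norm_sq_to_K, norm_pow, RCLike.norm_ofReal, abs_norm,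
      Real.sqrt_sq (norm_nonneg _)]
  -- (4) the vacuum-projected vectors lie in the span of the projected `Ψᵢ`, hence are good
  have hpV : V - ⟪hOS.vacuum, V⟫_ℂ • hOS.vacuum = ∑ i, c i •
      (hOS.fieldVec n k (g i) (hPi i) - ⟪hOS.vacuum, hOS.fieldVec n k (g i) (hPi i)⟫_ℂ •
        hOS.vacuum) := by
    rw [hV]
    simp only [inner_sum, inner_smul_right, Finset.sum_smul, smul_sub, smul_smul,
      Finset.sum_sub_distrib]
  have hpW : W - ⟪hOS.vacuum, W⟫_ℂ • hOS.vacuum = ∑ j, c' j •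
      (hOS.fieldVec m k' (g' j) (hQj j) - ⟪hOS.vacuum, hOS.fieldVec m k' (g' j) (hQj j)⟫_ℂ •
        hOS.vacuum) := by
    rw [hW]
    simp only [inner_sum, inner_smul_right, Finset.sum_smul, smul_sub, smul_smul,
      Finset.sum_sub_distrib]
  have hgoodV : ∀ s : ℝ, 0 ≤ s →
      (⟪V - ⟪hOS.vacuum, V⟫_ℂ • hOS.vacuum,
          hOS.transfer s (V - ⟪hOS.vacuum, V⟫_ℂ • hOS.vacuum)⟫_ℂ).re ≤
        ‖V - ⟪hOS.vacuum, V⟫_ℂ • hOS.vacuum‖ ^ 2 * Real.exp (-Δ * s) := by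
    rw [hpV]
    exact fun s hs => hOS.re_inner_transfer_self_le_sum c
      (fun i => hOS.fieldVec n k (g i) (hPi i) -
        ⟪hOS.vacuum, hOS.fieldVec n k (g i) (hPi i)⟫_ℂ • hOS.vacuum)
      (fun i => hgood n k _ (g i).2) hs
  have hgoodW : ∀ s : ℝ, 0 ≤ s →
      (⟪W - ⟪hOS.vacuum, W⟫_ℂ • hOS.vacuum,
          hOS.transfer s (W - ⟪hOS.vacuum, W⟫_ℂ • hOS.vacuum)⟫_ℂ).re ≤
        ‖W - ⟪hOS.vacuum, W⟫_ℂ • hOS.vacuum‖ ^ 2 * Real.exp (-Δ * s) := by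
    rw [hpW]
    exact fun s hs => hOS.re_inner_transfer_self_le_sum c'
      (fun j => hOS.fieldVec m k' (g' j) (hQj j) -
        ⟪hOS.vacuum, hOS.fieldVec m k' (g' j) (hQj j)⟫_ℂ • hOS.vacuum)
      (fun j => hgood m k' _ (g' j).2) hs
  -- (5) Cauchy–Schwarz for the projected vectors, and `‖v‖ ≤ ‖Ψ‖`
  have hid : ⟪V - ⟪hOS.vacuum, V⟫_ℂ • hOS.vacuum,
      hOS.transfer t (W - ⟪hOS.vacuum, W⟫_ℂ • hOS.vacuum)⟫_ℂ =
      T.schwinger (n + m) (Fin.append (k ∘ Fin.rev) k')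
          ((osAdjoint (∑ i, c i • (g i : 𝓢((Fin n → EuclideanSpace ℝ (Fin d)), ℂ)))).appendTensor
            (translateMulti (EuclideanSpace.single 0 t)
              (∑ j, c' j • (g' j : 𝓢((Fin m → EuclideanSpace ℝ (Fin d)), ℂ))))) -
        T.schwinger n (k ∘ Fin.rev)
            (osAdjoint (∑ i, c i • (g i : 𝓢((Fin n → EuclideanSpace ℝ (Fin d)), ℂ)))) *
          T.schwinger m k' (∑ j, c' j • (g' j : 𝓢((Fin m → EuclideanSpace ℝ (Fin d)), ℂ))) := by
    rw [hOS.inner_proj_transfer_proj h0, hVW, hVΩ, hΩW]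
  have key := hOS.norm_inner_transfer_le_of_le_exp hgoodV hgoodW ht
  rw [hid] at key
  rw [hnV, hnW]
  calc _ ≤ Real.exp (-Δ * t) * ‖V - ⟪hOS.vacuum, V⟫_ℂ • hOS.vacuum‖ *
        ‖W - ⟪hOS.vacuum, W⟫_ℂ • hOS.vacuum‖ := key
    _ ≤ Real.exp (-Δ * t) * ‖V‖ * ‖W‖ := by
        have hE : 0 ≤ Real.exp (-Δ * t) := (Real.exp_pos _).le
        have h1 := hOS.norm_sub_inner_vacuum_smul_le h0 V
        have h2 := hOS.norm_sub_inner_vacuum_smul_le h0 W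
        exact mul_le_mul (mul_le_mul_of_nonneg_left h1 hE) h2 (norm_nonneg _) (by positivity)

/-- **The converse transfer: full-spectrum gap of the limit ⇒ Cauchy–Schwarz clustering of the
lattice approximation.**  If `Λ k → 𝔖` on the off-diagonal real product tensors of every degree
`n ≥ 1` (the convergence clause of `IsQCDAlong` / `IsYangMillsFor`) and `T.HasMassGap Δ`, then
`ClustersCS d Λ Δ`: every term of the sesquilinearly expanded lattice inequality converges to its
continuum counterpart, the continuum inequality holds WITHOUT slack (`csBound_sum_of_hasMassGap`), so
with the slack `ε > 0` it is strict and therefore holds eventually in `k`.  Together with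
`hasMassGap_of_clustersCS`: along a convergent lattice approximation, `ClustersCS d Λ Δ ↔ T.HasMassGap Δ`.
[cite: GlimmJaffeQP1987, §6.1 Thm. 6.1.3] [cite: OsterwalderSeiler1978, §§2–4] -/
theorem clustersCS_of_hasMassGap (T : OSData ι d)
    (Λ : ℕ → (n : ℕ) → (Fin n → ι) → (Fin n → 𝓢(EuclideanSpace ℝ (Fin d), ℝ)) → ℂ)
    (hΛ : ∀ (n : ℕ), n ≠ 0 → ∀ (σ : Fin n → ι) (f : Fin n → 𝓢(EuclideanSpace ℝ (Fin d), ℝ))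
      (F : 𝓢((Fin n → EuclideanSpace ℝ (Fin d)), ℂ)), IsTensorOf F (fun i => ofRealTest (f i)) →
      IsOffDiagonal F → Tendsto (fun k => Λ k n σ f) atTop (𝓝 (T.schwinger n σ F)))
    {Δ : ℝ} (hgap : T.HasMassGap Δ) : ClustersCS d Λ Δ := by
  intro n m hn hm k k' N N' c c' p q hp hq t ht ε hε
  -- product tensors of the factor data
  let g : Fin N → ↥(slabOrderedProducts d n) := fun i =>
    ⟨SchwartzMap.tensorFin n (fun l => ofRealTest (p i l)),
      (hp i).mem_slabOrderedProducts (isTensorOf_tensorFin _)⟩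
  let g' : Fin N' → ↥(slabOrderedProducts d m) := fun j =>
    ⟨SchwartzMap.tensorFin m (fun l => ofRealTest (q j l)),
      (hq j).mem_slabOrderedProducts (isTensorOf_tensorFin _)⟩
  have hpT : ∀ i, IsTensorOf (g i : 𝓢((Fin n → EuclideanSpace ℝ (Fin d)), ℂ))
      (fun l => ofRealTest (p i l)) := fun i => isTensorOf_tensorFin _
  have hqT : ∀ j, IsTensorOf (g' j : 𝓢((Fin m → EuclideanSpace ℝ (Fin d)), ℂ))
      (fun l => ofRealTest (q j l)) := fun j => isTensorOf_tensorFin _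
  have hPi : ∀ i, IsTimeOrdered (g i : 𝓢((Fin n → EuclideanSpace ℝ (Fin d)), ℂ)) := fun i =>
    IsTimeOrdered.of_mem_slabOrderedProducts (g i).2
  have hQj : ∀ j, IsTimeOrdered (g' j : 𝓢((Fin m → EuclideanSpace ℝ (Fin d)), ℂ)) := fun j =>
    IsTimeOrdered.of_mem_slabOrderedProducts (g' j).2
  set a : EuclideanSpace ℝ (Fin d) := EuclideanSpace.single 0 t
  -- the continuum quantities of the expansion and their lattice approximants
  have hA : ∀ i j, Tendsto (fun κ => Λ κ (n + m) (Fin.append (k ∘ Fin.rev) k')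
        (Fin.append (fun l => thetaTest d (p i (Fin.rev l))) (fun l => translateTest a (q j l))))
      atTop (𝓝 (T.schwinger (n + m) (Fin.append (k ∘ Fin.rev) k')
        ((osAdjoint (g i : 𝓢((Fin n → EuclideanSpace ℝ (Fin d)), ℂ))).appendTensor
          (translateMulti a (g' j))))) := by
    intro i j
    refine hΛ (n + m) (by omega) _ _ _ ?_ ?_
    · have h := (hpT i).osAdjoint.appendTensor ((hqT j).translateMulti a)
      rwa [append_ofRealTest] at h
    · exact OSReconstructionNoE1.isOffDiagonal_appendTensor_osAdjoint (hPi i)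
        (OSReconstructionNoE1.isTimeOrdered_translateMulti (hQj j) (by simp [a, ht]))
  have hB : ∀ i, Tendsto (fun κ => Λ κ n (k ∘ Fin.rev) (fun l => thetaTest d (p i (Fin.rev l))))
      atTop (𝓝 (T.schwinger n (k ∘ Fin.rev)
        (osAdjoint (g i : 𝓢((Fin n → EuclideanSpace ℝ (Fin d)), ℂ))))) :=
    fun i => hΛ n hn _ _ _ (hpT i).osAdjoint (hPi i).isOffDiagonal.osAdjoint
  have hC : ∀ j, Tendsto (fun κ => Λ κ m k' (q j)) atTop
      (𝓝 (T.schwinger m k' (g' j : 𝓢((Fin m → EuclideanSpace ℝ (Fin d)), ℂ)))) :=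
    fun j => hΛ m hm _ _ _ (hqT j) (hQj j).isOffDiagonal
  have hD : ∀ i i', Tendsto (fun κ => Λ κ (n + n) (Fin.append (k ∘ Fin.rev) k)
        (Fin.append (fun l => thetaTest d (p i (Fin.rev l))) (p i')))
      atTop (𝓝 (T.schwinger (n + n) (Fin.append (k ∘ Fin.rev) k)
        ((osAdjoint (g i : 𝓢((Fin n → EuclideanSpace ℝ (Fin d)), ℂ))).appendTensor (g i')))) := by
    intro i i'
    refine hΛ (n + n) (by omega) _ _ _ ?_ ?_
    · have h := (hpT i).osAdjoint.appendTensor (hpT i')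
      rwa [append_ofRealTest] at h
    · exact OSReconstructionNoE1.isOffDiagonal_appendTensor_osAdjoint (hPi i) (hPi i')
  have hE : ∀ j j', Tendsto (fun κ => Λ κ (m + m) (Fin.append (k' ∘ Fin.rev) k')
        (Fin.append (fun l => thetaTest d (q j (Fin.rev l))) (q j')))
      atTop (𝓝 (T.schwinger (m + m) (Fin.append (k' ∘ Fin.rev) k')
        ((osAdjoint (g' j : 𝓢((Fin m → EuclideanSpace ℝ (Fin d)), ℂ))).appendTensor (g' j')))) := by
    intro j j'
    refine hΛ (m + m) (by omega) _ _ _ ?_ ?_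
    · have h := (hqT j).osAdjoint.appendTensor (hqT j')
      rwa [append_ofRealTest] at h
    · exact OSReconstructionNoE1.isOffDiagonal_appendTensor_osAdjoint (hQj j) (hQj j')
  -- sesquilinear expansions of the three continuum quantities
  have hL1 : T.schwinger (n + m) (Fin.append (k ∘ Fin.rev) k')
        ((osAdjoint (∑ i, c i • (g i : 𝓢((Fin n → EuclideanSpace ℝ (Fin d)), ℂ)))).appendTensor
          (translateMulti a (∑ j, c' j • (g' j : 𝓢((Fin m → EuclideanSpace ℝ (Fin d)), ℂ))))) -
      T.schwinger n (k ∘ Fin.rev)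
          (osAdjoint (∑ i, c i • (g i : 𝓢((Fin n → EuclideanSpace ℝ (Fin d)), ℂ)))) *
        T.schwinger m k' (∑ j, c' j • (g' j : 𝓢((Fin m → EuclideanSpace ℝ (Fin d)), ℂ))) =
      ∑ i, ∑ j, conj (c i) * c' j *
        (T.schwinger (n + m) (Fin.append (k ∘ Fin.rev) k')
            ((osAdjoint (g i : 𝓢((Fin n → EuclideanSpace ℝ (Fin d)), ℂ))).appendTensor
              (translateMulti a (g' j))) -
          T.schwinger n (k ∘ Fin.rev) (osAdjoint (g i : 𝓢((Fin n → EuclideanSpace ℝ (Fin d)), ℂ))) *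
            T.schwinger m k' (g' j : 𝓢((Fin m → EuclideanSpace ℝ (Fin d)), ℂ))) := by
    rw [map_sum, Finset.sum_congr rfl fun j _ => map_smul _ _ _,
      apply_osAdjoint_appendTensor_sum_smul, apply_osAdjoint_sum_smul, apply_sum_smul,
      Finset.sum_mul_sum, ← Finset.sum_sub_distrib]
    refine Finset.sum_congr rfl fun i _ => ?_
    rw [← Finset.sum_sub_distrib]
    exact Finset.sum_congr rfl fun j _ => by ring
  have hL2 : T.schwinger (n + n) (Fin.append (k ∘ Fin.rev) k)
      ((osAdjoint (∑ i, c i • (g i : 𝓢((Fin n → EuclideanSpace ℝ (Fin d)), ℂ)))).appendTensor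
        (∑ i, c i • (g i : 𝓢((Fin n → EuclideanSpace ℝ (Fin d)), ℂ)))) =
      ∑ i, ∑ i', conj (c i) * c i' * T.schwinger (n + n) (Fin.append (k ∘ Fin.rev) k)
        ((osAdjoint (g i : 𝓢((Fin n → EuclideanSpace ℝ (Fin d)), ℂ))).appendTensor (g i')) :=
    apply_osAdjoint_appendTensor_sum_smul _ _ _ _ _ _ _
  have hL3 : T.schwinger (m + m) (Fin.append (k' ∘ Fin.rev) k')
      ((osAdjoint (∑ j, c' j • (g' j : 𝓢((Fin m → EuclideanSpace ℝ (Fin d)), ℂ)))).appendTensor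
        (∑ j, c' j • (g' j : 𝓢((Fin m → EuclideanSpace ℝ (Fin d)), ℂ)))) =
      ∑ j, ∑ j', conj (c' j) * c' j' * T.schwinger (m + m) (Fin.append (k' ∘ Fin.rev) k')
        ((osAdjoint (g' j : 𝓢((Fin m → EuclideanSpace ℝ (Fin d)), ℂ))).appendTensor (g' j')) :=
    apply_osAdjoint_appendTensor_sum_smul _ _ _ _ _ _ _
  -- the continuum inequality (no slack), in expanded form
  have hcont := csBound_sum_of_hasMassGap T hgap k k' c c' g g' ht
  rw [hL1, hL2, hL3] at hcont
  -- the lattice sides converge to the continuum sides; the slack makes the limit inequality strict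
  have hlimL : Tendsto (fun κ => ‖∑ i, ∑ j, conj (c i) * c' j *
        (Λ κ (n + m) (Fin.append (k ∘ Fin.rev) k')
            (Fin.append (fun l => thetaTest d (p i (Fin.rev l)))
              (fun l => translateTest a (q j l))) -
          Λ κ n (k ∘ Fin.rev) (fun l => thetaTest d (p i (Fin.rev l))) * Λ κ m k' (q j))‖) atTop
      (𝓝 ‖∑ i, ∑ j, conj (c i) * c' j *
        (T.schwinger (n + m) (Fin.append (k ∘ Fin.rev) k')
            ((osAdjoint (g i : 𝓢((Fin n → EuclideanSpace ℝ (Fin d)), ℂ))).appendTensor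
              (translateMulti a (g' j))) -
          T.schwinger n (k ∘ Fin.rev) (osAdjoint (g i : 𝓢((Fin n → EuclideanSpace ℝ (Fin d)), ℂ))) *
            T.schwinger m k' (g' j : 𝓢((Fin m → EuclideanSpace ℝ (Fin d)), ℂ)))‖) := by
    refine Tendsto.norm (tendsto_finsetSum _ fun i _ => tendsto_finsetSum _ fun j _ => ?_)
    exact Tendsto.const_mul _ ((hA i j).sub ((hB i).mul (hC j)))
  have hlimR : Tendsto (fun κ => Real.exp (-Δ * t) *
        Real.sqrt ‖∑ i, ∑ i', conj (c i) * c i' *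
          Λ κ (n + n) (Fin.append (k ∘ Fin.rev) k)
            (Fin.append (fun l => thetaTest d (p i (Fin.rev l))) (p i'))‖ *
        Real.sqrt ‖∑ j, ∑ j', conj (c' j) * c' j' *
          Λ κ (m + m) (Fin.append (k' ∘ Fin.rev) k')
            (Fin.append (fun l => thetaTest d (q j (Fin.rev l))) (q j'))‖ + ε) atTop
      (𝓝 (Real.exp (-Δ * t) *
        Real.sqrt ‖∑ i, ∑ i', conj (c i) * c i' * T.schwinger (n + n) (Fin.append (k ∘ Fin.rev) k)
          ((osAdjoint (g i : 𝓢((Fin n → EuclideanSpace ℝ (Fin d)), ℂ))).appendTensor (g i'))‖ *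
        Real.sqrt ‖∑ j, ∑ j', conj (c' j) * c' j' *
          T.schwinger (m + m) (Fin.append (k' ∘ Fin.rev) k')
            ((osAdjoint (g' j : 𝓢((Fin m → EuclideanSpace ℝ (Fin d)), ℂ))).appendTensor (g' j'))‖ +
        ε)) := by
    refine ((tendsto_const_nhds.mul ?_).mul ?_).add_const ε
    · refine (Tendsto.norm (tendsto_finsetSum _ fun i _ => tendsto_finsetSum _ fun i' _ => ?_)).sqrt
      exact Tendsto.const_mul _ (hD i i')
    · refine (Tendsto.norm (tendsto_finsetSum _ fun j _ => tendsto_finsetSum _ fun j' _ => ?_)).sqrt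
      exact Tendsto.const_mul _ (hE j j')
  have hlt := lt_of_le_of_lt hcont (lt_add_of_pos_right _ hε)
  exact (hlimL.eventually_lt hlimR hlt).mono fun κ hκ => hκ.le

end OSData

/-- **Species CS clustering of lattice QCD from the continuum gap** (converse of
`IsQCDAlong.hasMassGap_of_hasSpeciesCSClustering`). [cite: JaffeWitten2000, §5] [cite: OsterwalderSeiler1978, §§2–4] -/
theorem IsQCDAlong.hasSpeciesCSClustering_of_hasMassGap {Nf : ℕ} {sch : QCDScheme Nf}
    {T : OSData (QCDField Nf) 4} (hT : IsQCDAlong sch T) {Δ : ℝ} (h : T.HasMassGap Δ) :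
    sch.HasSpeciesCSClustering Δ :=
  OSData.clustersCS_of_hasMassGap T (qcdLatticeSchwinger sch) hT.2.2 h

/-- **Along a QCD scheme, species CS clustering IS the continuum gap clause.** [cite: JaffeWitten2000, §5] -/
theorem IsQCDAlong.hasSpeciesCSClustering_iff_hasMassGap {Nf : ℕ} {sch : QCDScheme Nf}
    {T : OSData (QCDField Nf) 4} (hT : IsQCDAlong sch T) (Δ : ℝ) :
    sch.HasSpeciesCSClustering Δ ↔ T.HasMassGap Δ :=
  ⟨hT.hasMassGap_of_hasSpeciesCSClustering, hT.hasSpeciesCSClustering_of_hasMassGap⟩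

end Literature.MathematicalPhysics.QuantumFieldTheory

end
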